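import Mathlib
import Summits.ValiantsHypothesis.ValiantsHypothesis.Theorems.DivisionGapZeroOneTransferFaceIsolationDefs
import Summits.ValiantsHypothesis.ValiantsHypothesis.Theorems.DivisionGapZeroOneTransferBrickZoneUnique

/-!
# Crux `DivisionGap.ZeroOneTransfer` (stmt-ValiantsHypothesis-5066), line `charged-uncharged`, Part E (lead c13) —
stub `stub_u0_isSqDimer` (E4, THE EXPLICIT TILING `u₀` IS A DOMINO TILING)

The explicit recipe `u0Nat m b` of the Part-E vocabulary (plain horizontal dominoes in the rows `≥ 2m`,
bricks in the two brick-wall zones, and on each side of the zones a staircase of horizontal dominoes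
plus a growing run of vertical ones) is a fixed-point-free involution of the `n × n` square along
square-lattice edges, for `n, m, b` even with `2 ≤ m`, `m + 2 ≤ b`, `b + 2m + 2 ≤ n`; consequently the
vertex map `u0 m b` never takes its out-of-range fallback branch, agrees coordinatewise with `u0Nat`,
and is a domino tiling (`IsSqDimer`).

Everything is proved on `ℕ × ℕ`.  The Boolean / `if`-laden vocabulary (`wide`, `inZoneNat`, `zoneLeft`,
`newH`, `ctr`, `vert`, `brick`) is unfolded once into linear arithmetic with parities
(`BrickZoneUnique.inZoneNat_iff` of stub E3, `U0Tiling.newH_iff`, `U0Tiling.ctr_spec`, …), the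
value of `u0Nat` on each of its eight regions is recorded (`U0Tiling.u0Nat_left_newH`, …), and the
single lemma
`U0Tiling.main` then walks through the regions of a cell `p`: it computes `q = u0Nat p`, shows that
`q` is a square neighbour of `p` inside the square, determines the region of `q` and computes
`u0Nat q = p`.  The arithmetic facts used (all discharged by `omega`; `m` even is essential): a `newH`
row at step `t` has centre-distance `ctr ≥ t + 1`, so one column further out it is horizontal and not
`newH`; a non-`newH` horizontal row at step `t` has `t ≥ 1` (at `t = 0` every non-zone band row is
`newH`) and is `newH` at step `t - 1`, and at `t = 1` it is a narrow row, which misses the protruding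
columns `b - 1`, `b + m` of the zone; the vertical run `[m - t, m + t) ∩ [0, 2m)` has even length and
`vert` pairs consecutive rows inside it; the bricks pair a left zone cell with the right zone cell next
to it.  The recipe was also checked by computer for all admissible `(n, m, b)` with `n ≤ 60`. [folklore]
-/

noncomputable section

set_option linter.dupNamespace false

namespace Summit.ValiantsHypothesis.ValiantsHypothesis.Theorems.DivisionGapZeroOneTransfer

open MvPolynomial
open Literature.Computability.AlgebraicComplexity
open Summit.ValiantsHypothesis.ValiantsHypothesis.Theorems.TriangularDimersDivisionEasy.Negative
open FaceIsolation
open scoped NNReal BigOperators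

namespace U0Tiling

open BrickZoneUnique

/-! ### The vocabulary, unfolded to linear arithmetic with parities
(`wide_iff`, `zoneLeft_iff`, `zoneLeft_eq_false_iff`, `inZoneNat_iff` are reused from stub E3,
namespace `BrickZoneUnique`) -/

/-- The `newH` rows, unfolded. [folklore] -/
theorem newH_iff (m i t : ℕ) :
    newH m i t = true ↔ (i < m ∧ i % 2 = t % 2 ∨ m ≤ i ∧ i % 2 ≠ t % 2) := by
  simp [newH]

/-- The non-`newH` rows, unfolded. [folklore] -/
theorem newH_eq_false_iff (m i t : ℕ) :
    newH m i t = false ↔ ¬ (i < m ∧ i % 2 = t % 2 ∨ m ≤ i ∧ i % 2 ≠ t % 2) := by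
  rw [← newH_iff]
  simp

/-- The centre-distance `ctr`, unfolded. [folklore] -/
theorem ctr_spec (m i : ℕ) : (i < m ∧ ctr m i = m - 1 - i) ∨ (m ≤ i ∧ ctr m i = i - m) := by
  unfold ctr
  split_ifs with h <;> omega

/-- The vertical pairing, first case: the lower cell of a vertical domino. [folklore] -/
theorem vert_of_even {m t i j : ℕ} (h : (i + min t m - m) % 2 = 0) :
    vert m t (i, j) = (i + 1, j) := by
  simp [vert, h]

/-- The vertical pairing, second case: the upper cell of a vertical domino. [folklore] -/
theorem vert_of_odd {m t i j : ℕ} (h : ¬ (i + min t m - m) % 2 = 0) :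
    vert m t (i, j) = (i - 1, j) := by
  simp [vert, h]

/-- The brick of a left cell. [folklore] -/
theorem brick_of_left {m i j : ℕ} (h : zoneLeft m (i, j) = true) : brick m (i, j) = (i, j + 1) := by
  simp [brick, h]

/-- The brick of a right cell. [folklore] -/
theorem brick_of_right {m i j : ℕ} (h : zoneLeft m (i, j) = false) :
    brick m (i, j) = (i, j - 1) := by
  simp [brick, h]

/-! ### The value of `u0Nat` on each region -/

/-- `u0Nat` on the plain rows `≥ 2m`. [folklore] -/
theorem u0Nat_plain {m b i j : ℕ} (h : 2 * m ≤ i) :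
    u0Nat m b (i, j) = (i, if j % 2 = 0 then j + 1 else j - 1) := by
  dsimp only [u0Nat]
  rw [if_pos h]

/-- `u0Nat` on the zone: the brick partner. [folklore] -/
theorem u0Nat_zone {m b i j : ℕ} (h1 : ¬ 2 * m ≤ i) (h2 : inZoneNat m b (i, j)) :
    u0Nat m b (i, j) = brick m (i, j) := by
  dsimp only [u0Nat]
  rw [if_neg h1, if_pos h2]

/-- `u0Nat` on the left vertical run. [folklore] -/
theorem u0Nat_left_run {m b i j : ℕ} (h1 : ¬ 2 * m ≤ i) (h2 : ¬ inZoneNat m b (i, j))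
    (h3 : j + 1 ≤ b) (h4 : ctr m i < b - 1 - j) :
    u0Nat m b (i, j) = vert m (b - 1 - j) (i, j) := by
  dsimp only [u0Nat]
  rw [if_neg h1, if_neg h2, if_pos h3, if_pos h4]

/-- `u0Nat` on a left `newH` row: a new horizontal domino pointing away from the zone. [folklore] -/
theorem u0Nat_left_newH {m b i j : ℕ} (h1 : ¬ 2 * m ≤ i) (h2 : ¬ inZoneNat m b (i, j))
    (h3 : j + 1 ≤ b) (h4 : ¬ ctr m i < b - 1 - j) (h5 : newH m i (b - 1 - j) = true) :
    u0Nat m b (i, j) = (i, j - 1) := by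
  dsimp only [u0Nat]
  rw [if_neg h1, if_neg h2, if_pos h3, if_neg h4, if_pos h5]

/-- `u0Nat` on a left non-`newH` horizontal row: the far end of the previous step's domino.
[folklore] -/
theorem u0Nat_left_else {m b i j : ℕ} (h1 : ¬ 2 * m ≤ i) (h2 : ¬ inZoneNat m b (i, j))
    (h3 : j + 1 ≤ b) (h4 : ¬ ctr m i < b - 1 - j) (h5 : newH m i (b - 1 - j) = false) :
    u0Nat m b (i, j) = (i, j + 1) := by
  dsimp only [u0Nat]
  rw [if_neg h1, if_neg h2, if_pos h3, if_neg h4, if_neg (by simpa using h5)]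

/-- `u0Nat` on the right vertical run. [folklore] -/
theorem u0Nat_right_run {m b i j : ℕ} (h1 : ¬ 2 * m ≤ i) (h2 : ¬ inZoneNat m b (i, j))
    (h3 : ¬ j + 1 ≤ b) (h4 : ctr m i < j - (b + m)) :
    u0Nat m b (i, j) = vert m (j - (b + m)) (i, j) := by
  dsimp only [u0Nat]
  rw [if_neg h1, if_neg h2, if_neg h3, if_pos h4]

/-- `u0Nat` on a right `newH` row. [folklore] -/
theorem u0Nat_right_newH {m b i j : ℕ} (h1 : ¬ 2 * m ≤ i) (h2 : ¬ inZoneNat m b (i, j))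
    (h3 : ¬ j + 1 ≤ b) (h4 : ¬ ctr m i < j - (b + m)) (h5 : newH m i (j - (b + m)) = true) :
    u0Nat m b (i, j) = (i, j + 1) := by
  dsimp only [u0Nat]
  rw [if_neg h1, if_neg h2, if_neg h3, if_neg h4, if_pos h5]

/-- `u0Nat` on a right non-`newH` horizontal row. [folklore] -/
theorem u0Nat_right_else {m b i j : ℕ} (h1 : ¬ 2 * m ≤ i) (h2 : ¬ inZoneNat m b (i, j))
    (h3 : ¬ j + 1 ≤ b) (h4 : ¬ ctr m i < j - (b + m)) (h5 : newH m i (j - (b + m)) = false) :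
    u0Nat m b (i, j) = (i, j - 1) := by
  dsimp only [u0Nat]
  rw [if_neg h1, if_neg h2, if_neg h3, if_neg h4, if_neg (by simpa using h5)]

/-- Equality of pairs of naturals from equality of the coordinates. [folklore] -/
theorem pair_eq {a b c d : ℕ} (h1 : a = c) (h2 : b = d) : (a, b) = (c, d) := by
  rw [h1, h2]

/-! ### The involution, region by region -/

/-- **Main lemma (on `ℕ × ℕ`).**  Under the hypotheses of rung E-I, for every cell `(i, j)` of the
`n × n` square, `u0Nat` is an involution at `(i, j)` and `u0Nat (i, j)` is one of the four square
neighbours of `(i, j)`, inside the square. [folklore] -/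
theorem main {n m b i j : ℕ} (hn2 : n % 2 = 0) (hm2 : m % 2 = 0) (hb2 : b % 2 = 0) (h2m : 2 ≤ m)
    (hmb : m + 2 ≤ b) (hbn : b + 2 * m + 2 ≤ n) (hi : i < n) (hj : j < n) :
    u0Nat m b (u0Nat m b (i, j)) = (i, j) ∧
    (((u0Nat m b (i, j)).1 = i + 1 ∧ (u0Nat m b (i, j)).2 = j ∧ i + 1 < n) ∨
      ((u0Nat m b (i, j)).1 = i - 1 ∧ (u0Nat m b (i, j)).2 = j ∧ 1 ≤ i) ∨
      ((u0Nat m b (i, j)).1 = i ∧ (u0Nat m b (i, j)).2 = j + 1 ∧ j + 1 < n) ∨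
      ((u0Nat m b (i, j)).1 = i ∧ (u0Nat m b (i, j)).2 = j - 1 ∧ 1 ≤ j)) := by
  by_cases hi2 : 2 * m ≤ i
  · -- plain rows
    rw [u0Nat_plain hi2]
    by_cases hpar : j % 2 = 0
    · rw [if_pos hpar]
      refine ⟨?_, Or.inr (Or.inr (Or.inl ⟨rfl, rfl, by omega⟩))⟩
      rw [u0Nat_plain hi2, if_neg (by omega)]
      exact pair_eq rfl (by omega)
    · rw [if_neg hpar]
      refine ⟨?_, Or.inr (Or.inr (Or.inr ⟨rfl, rfl, by omega⟩))⟩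
      rw [u0Nat_plain hi2, if_pos (by omega)]
      exact pair_eq rfl (by omega)
  by_cases hz : inZoneNat m b (i, j)
  · -- zone cells: bricks
    have hz' := (inZoneNat_iff m b i j).1 hz
    rw [u0Nat_zone hi2 hz]
    cases hl : zoneLeft m (i, j)
    · -- a right cell
      have hl' := (zoneLeft_eq_false_iff m i j).1 hl
      rw [brick_of_right hl]
      refine ⟨?_, Or.inr (Or.inr (Or.inr ⟨rfl, rfl, by omega⟩))⟩
      have hz1 : inZoneNat m b (i, j - 1) := by rw [inZoneNat_iff]; omega
      have hl1 : zoneLeft m (i, j - 1) = true := by rw [zoneLeft_iff]; omega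
      rw [u0Nat_zone hi2 hz1, brick_of_left hl1]
      exact pair_eq rfl (by omega)
    · -- a left cell
      have hl' := (zoneLeft_iff m i j).1 hl
      rw [brick_of_left hl]
      refine ⟨?_, Or.inr (Or.inr (Or.inl ⟨rfl, rfl, by omega⟩))⟩
      have hz1 : inZoneNat m b (i, j + 1) := by rw [inZoneNat_iff]; omega
      have hl1 : zoneLeft m (i, j + 1) = false := by rw [zoneLeft_eq_false_iff]; omega
      rw [u0Nat_zone hi2 hz1, brick_of_right hl1]
      exact pair_eq rfl (by omega)
  have hz' := hz
  rw [inZoneNat_iff] at hz'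
  have hcs := ctr_spec m i
  by_cases hjb : j + 1 ≤ b
  · -- LEFT of the zone, step `t = b - 1 - j`
    by_cases hc : ctr m i < b - 1 - j
    · -- the vertical run
      rw [u0Nat_left_run hi2 hz hjb hc]
      by_cases hpar : (i + min (b - 1 - j) m - m) % 2 = 0
      · rw [vert_of_even hpar]
        refine ⟨?_, Or.inl ⟨rfl, rfl, by omega⟩⟩
        have h1 : ¬ 2 * m ≤ i + 1 := by omega
        have h2 : ¬ inZoneNat m b (i + 1, j) := by rw [inZoneNat_iff]; omega
        have h4 : ctr m (i + 1) < b - 1 - j := by have := ctr_spec m (i + 1); omega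
        rw [u0Nat_left_run h1 h2 hjb h4, vert_of_odd (by omega)]
        exact pair_eq (by omega) rfl
      · rw [vert_of_odd hpar]
        have hi1 : 1 ≤ i := by omega
        refine ⟨?_, Or.inr (Or.inl ⟨rfl, rfl, hi1⟩)⟩
        have h1 : ¬ 2 * m ≤ i - 1 := by omega
        have h2 : ¬ inZoneNat m b (i - 1, j) := by rw [inZoneNat_iff]; omega
        have h4 : ctr m (i - 1) < b - 1 - j := by have := ctr_spec m (i - 1); omega
        rw [u0Nat_left_run h1 h2 hjb h4, vert_of_even (by omega)]
        exact pair_eq (by omega) rfl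
    · cases hnh : newH m i (b - 1 - j)
      · -- a non-`newH` horizontal row: the far end `(i, j + 1)` of a domino of step `t - 1`
        have hn' := (newH_eq_false_iff _ _ _).1 hnh
        rw [u0Nat_left_else hi2 hz hjb hc hnh]
        refine ⟨?_, Or.inr (Or.inr (Or.inl ⟨rfl, rfl, by omega⟩))⟩
        have h2 : ¬ inZoneNat m b (i, j + 1) := by rw [inZoneNat_iff]; omega
        have h3 : j + 1 + 1 ≤ b := by omega
        have h4 : ¬ ctr m i < b - 1 - (j + 1) := by omega
        have h5 : newH m i (b - 1 - (j + 1)) = true := by rw [newH_iff]; omega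
        rw [u0Nat_left_newH hi2 h2 h3 h4 h5]
        exact pair_eq rfl (by omega)
      · -- a `newH` row: a new domino `(i, j - 1) – (i, j)`
        have hn' := (newH_iff _ _ _).1 hnh
        rw [u0Nat_left_newH hi2 hz hjb hc hnh]
        have hj1 : 1 ≤ j := by omega
        refine ⟨?_, Or.inr (Or.inr (Or.inr ⟨rfl, rfl, hj1⟩))⟩
        have h2 : ¬ inZoneNat m b (i, j - 1) := by rw [inZoneNat_iff]; omega
        have h3 : j - 1 + 1 ≤ b := by omega
        have h4 : ¬ ctr m i < b - 1 - (j - 1) := by omega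
        have h5 : newH m i (b - 1 - (j - 1)) = false := by rw [newH_eq_false_iff]; omega
        rw [u0Nat_left_else hi2 h2 h3 h4 h5]
        exact pair_eq rfl (by omega)
  · -- RIGHT of the zone, step `t = j - (b + m)`
    have hjm : b + m ≤ j := by omega
    by_cases hc : ctr m i < j - (b + m)
    · -- the vertical run
      rw [u0Nat_right_run hi2 hz hjb hc]
      by_cases hpar : (i + min (j - (b + m)) m - m) % 2 = 0
      · rw [vert_of_even hpar]
        refine ⟨?_, Or.inl ⟨rfl, rfl, by omega⟩⟩
        have h1 : ¬ 2 * m ≤ i + 1 := by omega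
        have h2 : ¬ inZoneNat m b (i + 1, j) := by rw [inZoneNat_iff]; omega
        have h4 : ctr m (i + 1) < j - (b + m) := by have := ctr_spec m (i + 1); omega
        rw [u0Nat_right_run h1 h2 hjb h4, vert_of_odd (by omega)]
        exact pair_eq (by omega) rfl
      · rw [vert_of_odd hpar]
        have hi1 : 1 ≤ i := by omega
        refine ⟨?_, Or.inr (Or.inl ⟨rfl, rfl, hi1⟩)⟩
        have h1 : ¬ 2 * m ≤ i - 1 := by omega
        have h2 : ¬ inZoneNat m b (i - 1, j) := by rw [inZoneNat_iff]; omega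
        have h4 : ctr m (i - 1) < j - (b + m) := by have := ctr_spec m (i - 1); omega
        rw [u0Nat_right_run h1 h2 hjb h4, vert_of_even (by omega)]
        exact pair_eq (by omega) rfl
    · cases hnh : newH m i (j - (b + m))
      · -- a non-`newH` horizontal row: the far end `(i, j - 1)` of a domino of step `t - 1`
        have hn' := (newH_eq_false_iff _ _ _).1 hnh
        rw [u0Nat_right_else hi2 hz hjb hc hnh]
        have hj1 : 1 ≤ j := by omega
        refine ⟨?_, Or.inr (Or.inr (Or.inr ⟨rfl, rfl, hj1⟩))⟩
        have h2 : ¬ inZoneNat m b (i, j - 1) := by rw [inZoneNat_iff]; omega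
        have h3 : ¬ j - 1 + 1 ≤ b := by omega
        have h4 : ¬ ctr m i < j - 1 - (b + m) := by omega
        have h5 : newH m i (j - 1 - (b + m)) = true := by rw [newH_iff]; omega
        rw [u0Nat_right_newH hi2 h2 h3 h4 h5]
        exact pair_eq rfl (by omega)
      · -- a `newH` row: a new domino `(i, j) – (i, j + 1)`
        have hn' := (newH_iff _ _ _).1 hnh
        rw [u0Nat_right_newH hi2 hz hjb hc hnh]
        refine ⟨?_, Or.inr (Or.inr (Or.inl ⟨rfl, rfl, by omega⟩))⟩
        have h2 : ¬ inZoneNat m b (i, j + 1) := by rw [inZoneNat_iff]; omega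
        have h3 : ¬ j + 1 + 1 ≤ b := by omega
        have h4 : ¬ ctr m i < j + 1 - (b + m) := by omega
        have h5 : newH m i (j + 1 - (b + m)) = false := by rw [newH_eq_false_iff]; omega
        rw [u0Nat_right_else hi2 h2 h3 h4 h5]
        exact pair_eq rfl (by omega)

end U0Tiling

open U0Tiling in
/-- **Stub E4 — THE EXPLICIT TILING `u₀` IS A DOMINO TILING.**  For `n, m, b` even with `2 ≤ m`,
`m + 2 ≤ b`, `b + 2m + 2 ≤ n`, the vertex map `u0 m b` of the `n × n` square is a fixed-point-free
involution along square-lattice edges, and it agrees coordinatewise with the `ℕ`-recipe `u0Nat m b`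
(the out-of-range fallback of `u0` is never taken). [folklore] -/
theorem stub_u0_isSqDimer : ∀ (n m b : ℕ), Even n → Even m → Even b → 2 ≤ m → m + 2 ≤ b →
    b + 2 * m + 2 ≤ n →
    IsSqDimer (u0 (n := n) m b) ∧
    ∀ v : Vtx n, ((u0 m b v).1 : ℕ) = (u0Nat m b ((v.1 : ℕ), (v.2 : ℕ))).1 ∧
      ((u0 m b v).2 : ℕ) = (u0Nat m b ((v.1 : ℕ), (v.2 : ℕ))).2 := by
  intro n m b hn hm hb h2m hmb hbn
  have hn2 : n % 2 = 0 := Nat.even_iff.1 hn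
  have hm2 : m % 2 = 0 := Nat.even_iff.1 hm
  have hb2 : b % 2 = 0 := Nat.even_iff.1 hb
  have hmain : ∀ v : Vtx n, _ := fun v : Vtx n =>
    main (i := (v.1 : ℕ)) (j := (v.2 : ℕ)) hn2 hm2 hb2 h2m hmb hbn v.1.2 v.2.2
  -- the `ℕ`-partner stays inside the square
  have hA : ∀ v : Vtx n, (u0Nat m b ((v.1 : ℕ), (v.2 : ℕ))).1 < n ∧
      (u0Nat m b ((v.1 : ℕ), (v.2 : ℕ))).2 < n := by
    intro v
    have hv1 := v.1.2
    have hv2 := v.2.2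
    rcases (hmain v).2 with ⟨h1, h2, h3⟩ | ⟨h1, h2, h3⟩ | ⟨h1, h2, h3⟩ | ⟨h1, h2, h3⟩ <;> omega
  -- hence `u0` takes its first branch and agrees with `u0Nat`
  have hco : ∀ v : Vtx n, ((u0 m b v).1 : ℕ) = (u0Nat m b ((v.1 : ℕ), (v.2 : ℕ))).1 ∧
      ((u0 m b v).2 : ℕ) = (u0Nat m b ((v.1 : ℕ), (v.2 : ℕ))).2 := by
    intro v
    have h := hA v
    unfold u0
    rw [dif_pos h]
    exact ⟨rfl, rfl⟩
  refine ⟨fun v => ⟨?_, ?_, ?_⟩, hco⟩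
  · -- involution
    obtain ⟨h1, h2⟩ := hco (u0 m b v)
    obtain ⟨h3, h4⟩ := hco v
    have key := (hmain v).1
    rw [h3, h4, Prod.mk.eta, key] at h1 h2
    exact Prod.ext (Fin.ext h1) (Fin.ext h2)
  · -- no fixed point
    intro heq
    obtain ⟨h3, h4⟩ := hco v
    rw [heq] at h3 h4
    have hv1 := v.1.2
    have hv2 := v.2.2
    rcases (hmain v).2 with ⟨h5, h6, h7⟩ | ⟨h5, h6, h7⟩ | ⟨h5, h6, h7⟩ | ⟨h5, h6, h7⟩ <;> omega
  · -- along a square edge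
    obtain ⟨h3, h4⟩ := hco v
    unfold SqAdj
    rcases (hmain v).2 with ⟨h5, h6, h7⟩ | ⟨h5, h6, h7⟩ | ⟨h5, h6, h7⟩ | ⟨h5, h6, h7⟩ <;> omega

end Summit.ValiantsHypothesis.ValiantsHypothesis.Theorems.DivisionGapZeroOneTransfer

end
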